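import Mathlib
import Summits.ValiantsHypothesis.ValiantsHypothesis.Theses.LacunarySymmetroid
import Summits.ValiantsHypothesis.ValiantsHypothesis.Theorems.MatrixDescartes.Negative.MatrixDescartesWitness24
import Literature.Computability.AlgebraicComplexity.RealTauKnownCases

/-!
# LINE `nappe-walk` (D-0145 skeleton, val-idea-5 GEN 3, lens = ANOMALY) — items `DoorA26` (stmt-ValiantsHypothesis-19979,
# by name) and `MatrixDescartes` (stmt-ValiantsHypothesis-18050, row `m = 2` only)
# «THE SYMMETRIC TIE IS A SHALLOW LENS»: wraps versus lenses of the two-nappe inertia walk, and the rootless-frame split of the door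

HONEST FRAMING.  Nothing here proves `DoorA26`, V18, `MatrixDescartes` or Conjecture B, and `VP ≠ VNP` is not moved by it.
(v2, same gen) The ONLY two `sorry`s are the two HALVES of the door (`stub_door_rootlessFrame`, `stub_door_noFrame`) — the
conjectural content.  Everything else is PROVED in this file: the typed anomaly `anomaly_W24` (the tree's `(2,4)` extremal
witness has a rootless — indeed posynomial — frame), the congruence normal form (`pencil_congr`, `congr_posRoots`, `comp_congr`,
`doorRootlessFrame_iff_diagonal`), the capacity instrument (`comp_eval`, `wrap_root`: a wrap costs a root of EVERY compression;
`lens_two_roots`: a lens costs two roots of every compression that sees it; `comp_descartes`: a compression has ≤ K − 1 positive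
roots, via `Literature…card_roots_toFinset_filter_pos_lt_card_support`), the compositions and the kill switch.

THE MEASURED ANOMALY (this seat, exact arithmetic; instrument `lens/wrapcensus.py` + `lens/lens.py` over the cell's located
census records `pub-symmetroid/census/records/2-K.jsonl`, every row at the record value whose certified alternation points
separate the roots).  Write the inertia type of `F(x) = Σ x^{dₗ}Sₗ` on the `Z+1` components of `{det F ≠ 0} ∩ (0,∞)` as a
walk in `{P, N, i}` (positive definite / negative definite / indefinite).  A bounded `i`-component between two definite
components of OPPOSITE type is a WRAP (the moment curve passes from one nappe of the cone `{det ≥ 0} = PSD ∪ NSD` to the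
other), of the SAME type a LENS (an excursion returning to the same nappe); `a ∈ {0,1,2}` counts unbounded `i`-components.
Always `Z = 2(w + c) + a` (topology).  CENSUS: `(2,4)`, Z = 9, 255 rows: `w = 0` in 208, `w = 1` in 47 (walk `iPiPiPiPiN`,
supports `(0,1,3,15…20)`), `a = 1` always; `(2,5)`, Z = 14, 194 rows: `w = 0`, `a = 0`, det-signature `+---+` in ALL rows
(walk `PiPiPiPiPiPiPiP`: seven lenses on ONE nappe); `(2,6)`, Z = 18, 540 rows: `w = 0` in 539, `w = 1` in 1
(`E1G5-BGRAFT18-2-6-0-7-12-15-16-97`, walk `PiPiPiNiNiNiNiNiNiN`), `(c,a) = (9,0)` with signature `+----+` in 332 rows and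
`(8,2)` with ALL SIX LETTERS INDEFINITE in 208 rows; `(2,8)` G25, Z = 25: `w = 1`, `c = 11`, `a = 1`.  ROOTLESS DIRECTIONS
(a `w ∈ ℝ² ∖ 0` whose compression `f_w = wᵀFw`, a K-nomial, has no positive root): `(2,4)` 208/255 rows (exactly the `w = 0`
rows), `(2,5)` 194/194, `(2,6)` 539/540 (numerical scan; a POSYNOMIAL direction — all `wᵀSₗw > 0`, Descartes-certified — in
208/255, 168/194, 209/540).  The tree's witnesses: W24 `(0,2,6,11)`: `F₀₀ = 5961 − 15677x² − 1450x⁶ + 10⁵x¹¹` has NO positive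
root (Sturm; its minimum is ≈ 5.33 at x ≈ 0.678 against coefficients ~10⁵ — the extremal sits razor-close to the boundary
of the rootless-frame class), `F₁₁` is a posynomial, `F₀₁` has one positive root; T14 and G18 likewise have both diagonal
entries rootless and all `Z/2` lenses on one nappe, with pairwise disjoint isotropic-direction arcs of width ≤ 9° (mostly
< 0.25°).  READING: the «symmetric tie» (`(2,4) = 9 > 8`, `(2,5) = 14 > 13` over the tropical capacity) is realised by
SHALLOW SAME-NAPPE LENSES (near-ties `AC ≈ B²` seen from a rootless frame), never by wraps: wraps are capped by Descartes on
every compression (`w ≤ min_w Z₊(f_w) ≤ K − 1`, lemma `wrap_root` below) and are located-rare (`w ≤ 1` in every record row).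

THE SPLIT (new lever; kernel composition `doorA26_of_stubs`).  `HasRootlessFrame d S`: some invertible `P` has both columns
rootless.  (A) `DoorRootlessFrame`: such pencils have ≤ 19 positive roots at `(2,6)`.  WHY EASIER (named tools): after the
congruence `S ↦ PᵀSP` (same roots: `congr_posRoots`) both diagonal entries `A, C` are of one sign on `(0,∞)`; opposite signs
⇒ `F` indefinite everywhere ⇒ `Z = 0`; equal signs (WLOG `+`) ⇒ NO WRAPS, every root is a transversal crossing of ONE nappe,
`Z = #zeros` of the Schur complement `s = C − B²/A`, a real-analytic function on `(0,∞)` — equivalently of the LOWER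
ENVELOPE `min_c (c²A − 2cB + C)` of a one-parameter family of K-nomials each with ≤ K−1 positive roots; when the frame is
posynomial (`aₗ > 0`), Cauchy–Schwarz gives the exact split `AC − B² = A·G + Q`, `G = Σₗ (det Sₗ/aₗ) x^{dₗ}` (a K-nomial
carrying the letter signature, `+−−−−+` on 332/540 rows ⇒ `{G < 0}` is ONE interval containing all roots) and `Q =
Σ_{i<j} aᵢaⱼ(bᵢ/aᵢ − bⱼ/aⱼ)² x^{dᵢ+dⱼ}` coefficientwise ≥ 0.  (B) `DoorNoFrame`: pencils whose rootless directions do not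
span `ℝ²` have ≤ 19.  WHY EASIER: then (generically) EVERY compression vanishes on `(0,∞)`, so either `w ≥ 1` or the isotropic
arcs of the lenses cover `ℝP¹`; the capacity inequalities `w + 2·n_w ≤ Z₊(f_w) ≤ K − 1 = 5` (`wrap_root`, `lens_two_roots`,
`comp_descartes`; `n_w` = lenses on which `f_w` goes negative) then bind in every direction at once, and every wrap contains
a root of EACH entry `A, B, C`.  Neither half is located-easier (both classes attain 18 at `(2,6)`: 539 rows / 1 row) — the
value of the split is that the two halves have DIFFERENT available tools, and that any 20-root pencil must have
`(c + w, a) ∈ {(10,0), (9,2)}` with `w ≤ 5`.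
WHY NOVEL vs the listed lines (one line each): `bottom-nappe-law` (val-idea-3) splits roots by definite-boundary vs middle and
notes that at m = 2 every root is definite-boundary — it does not separate the two nappes (wrap vs lens) nor use compressions;
`rolle-schur-residual` uses `compDet` as an m-step residual handle, not as a wrap counter; `span-rank` (val-idea-1) is the
rank-3 Gram / K-nomial-curve-vs-conic picture without topology; `gram-loewner-vlaw` uses kernel vectors at down-crossings of
PSD-atom pencils; `unit-subtropical` (this seat, g2) gives the same VALUE `4K − 6` at m = 2 as a format law with no mechanism;
`hyperbolic-door`/`finite-sector` (val-idea-6) restrict to real-rooted-simple determinants, an unrelated sector.  Prior art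
searched: inertia walks are a cell instrument (bottom-nappe card §(iii), STRUCTURE walks `1212…`); no line or card types
rootless directions, wraps, or the capacity inequality (rg over Cruxes/*/Ideas, Cruxes/*/Lines, Theses: no hit for
rootless|isotropic arc|wrap).  Literature: lower envelopes of Chebyshev/Descartes systems (Karlin–Studden) bound zeros of ONE
element, not of the envelope; convex curves vs quadrics (Shapiro–Sedykh arXiv:math/0208218) carry no bound without the
fewnomial structure (a convex N-gon meets a circle 2N times) — recorded as a dead abstraction in the card.
BEARS ON: rung DoorA26 (19979) BY NAME (`doorA26_of_stubs`), V18/`MatrixDescartes` (18050) only through the row m = 2.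
CHEAPEST FALSIFIER: one symmetric `(2,6)` pencil with 20 positive roots kills both halves (`not_doors_of_twenty`); cheaper and
class-specific: a kit search maximising Z over `(2,6)` pencils constrained to `w ≥ 1` (prediction ≤ 18; 19 kills (B) alone) and
over posynomial-frame pencils (prediction 18; 19/20 kills (A)); instrument thresholds: any record row with `w ≥ 2`, or a `(2,5)`
fourteen with a wrap, refutes the located reading (not the stubs).
INSTRUMENT ROW: `wrapcensus.py K` → per format: distribution of `(w, a)`, det-signatures, rootless / posynomial directions,
exceptions list; `lens.py <row>` → walk, per-lens isotropic arc, `Z₊(A), Z₊(B), Z₊(C)`.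
-/

set_option linter.dupNamespace false
set_option linter.unusedVariables false
set_option autoImplicit false

open Polynomial Matrix

namespace Summit.ValiantsHypothesis.ValiantsHypothesis.Cruxes.DoorA26.NappeWalk

open Summit.ValiantsHypothesis.ValiantsHypothesis.Theorems.MatrixDescartes.Negative (PosRootLawAt S₂₄ d₂₄)

variable {K : ℕ}

/-! ## 0. Objects -/

/-- the lacunary symmetric `2 × 2` pencil `F = Σₗ x^{dₗ} Sₗ` as a polynomial matrix (same expression as in `DoorA26`). -/
noncomputable def pencil (d : Fin K → ℕ) (S : Fin K → Matrix (Fin 2) (Fin 2) ℝ) : Matrix (Fin 2) (Fin 2) ℝ[X] :=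
  ∑ l, ((X : ℝ[X]) ^ d l) • (S l).map C

/-- its value at a real point. -/
def evalAt (d : Fin K → ℕ) (S : Fin K → Matrix (Fin 2) (Fin 2) ℝ) (x : ℝ) : Matrix (Fin 2) (Fin 2) ℝ :=
  ∑ l, (x ^ d l) • S l

/-- number of distinct positive roots (the census currency). -/
noncomputable def posRoots (p : ℝ[X]) : ℕ := (p.roots.toFinset.filter (fun x => 0 < x)).card

/-- the COMPRESSION of the pencil along `w`: the K-nomial `f_w = wᵀ F w = Σₗ (wᵀ Sₗ w) x^{dₗ}`. -/
noncomputable def comp (d : Fin K → ℕ) (S : Fin K → Matrix (Fin 2) (Fin 2) ℝ) (w : Fin 2 → ℝ) : ℝ[X] :=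
  ∑ l, C (w ⬝ᵥ (S l).mulVec w) * (X : ℝ[X]) ^ d l

/-- the congruent letter family `Pᵀ Sₗ P`. -/
def congr (P : Matrix (Fin 2) (Fin 2) ℝ) (S : Fin K → Matrix (Fin 2) (Fin 2) ℝ) :
    Fin K → Matrix (Fin 2) (Fin 2) ℝ :=
  fun l => Pᵀ * S l * P

/-- ROOTLESS FRAME: an invertible `P` both of whose columns are rootless directions (their compressions never vanish on
`(0,∞)`).  Equivalent to «the rootless directions span ℝ²»; after the congruence both diagonal entries are of one sign. -/
def HasRootlessFrame (d : Fin K → ℕ) (S : Fin K → Matrix (Fin 2) (Fin 2) ℝ) : Prop :=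
  ∃ P : Matrix (Fin 2) (Fin 2) ℝ, P.det ≠ 0 ∧
    ∀ i : Fin 2, ∀ x : ℝ, 0 < x → (comp d S (fun j => P j i)).eval x ≠ 0

/-! ## 1. The typed anomaly -/

/-- evaluation of a compression as a finite sum: `f_w(t) = Σₗ (wᵀSₗw) t^{dₗ}` (proved). -/
theorem comp_eval_sum (d : Fin K → ℕ) (S : Fin K → Matrix (Fin 2) (Fin 2) ℝ) (w : Fin 2 → ℝ) (t : ℝ) :
    (comp d S w).eval t = ∑ l, (w ⬝ᵥ (S l).mulVec w) * t ^ d l := by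
  unfold comp
  rw [Polynomial.eval_finsetSum]
  refine Finset.sum_congr rfl (fun l _ => ?_)
  rw [Polynomial.eval_mul, Polynomial.eval_C, Polynomial.eval_pow, Polynomial.eval_X]

/-- the POSYNOMIAL FRAME of the tree's `(2,4)` witness: columns `(1,1)` and `(0,1)` (both compressions have all four
coefficients positive: `53877, 76843, 204205, 116450` and `96396, 27640, 15059, 626`).  Measured: the posynomial directions
of `S₂₄` form ONE arc `θ ∈ (32.3°, 189.0°)` of `ℝP¹`; the frame `P = 1` is rootless too (`F₀₀ = 5961 − 15677x² − 1450x⁶ +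
10⁵x¹¹ > 0` by Sturm, minimum ≈ 5.33 near `x ≈ 0.678` — razor-thin, not formalised). -/
def P₂₄ : Matrix (Fin 2) (Fin 2) ℝ := !![1, 0; 1, 1]

/-- **THE TYPED ANOMALY (was STUB, now PROVED):** the Descartes-extremal `(2,4)` witness `(d₂₄, S₂₄)` (nine positive roots,
`nine_le_card_posRoots_F₂₄`; the `9 > 8` symmetric tie) HAS A ROOTLESS FRAME — all nine of its roots are same-nappe lens
crossings seen from the posynomial frame `P₂₄`.  Located companions (instrument, not typed): T14 `(2,5)`, G18 `(2,6)` and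
539/540 record rows at `(2,6)`. -/
theorem anomaly_W24 : HasRootlessFrame d₂₄ S₂₄ := by
  refine ⟨P₂₄, by simp [P₂₄, Matrix.det_fin_two], ?_⟩
  intro i x hx
  rw [comp_eval_sum, Fin.sum_univ_four]
  fin_cases i <;>
    simp [P₂₄, S₂₄, d₂₄, Matrix.mulVec, dotProduct, Fin.sum_univ_two] <;> norm_num <;> positivity

/-! ## 2. Kernel-gradable structure (M-sized stubs: congruence, IVT, Descartes) -/

/-- congruence preserves symmetry (proved). -/
theorem congr_symm (P : Matrix (Fin 2) (Fin 2) ℝ) (S : Fin K → Matrix (Fin 2) (Fin 2) ℝ)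
    (hS : ∀ l, (S l).IsSymm) (l : Fin K) : (congr P S l).IsSymm := by
  unfold congr Matrix.IsSymm
  rw [Matrix.transpose_mul, Matrix.transpose_mul, Matrix.transpose_transpose, (hS l).eq, Matrix.mul_assoc]

/-- the congruent pencil is `(P.map C)ᵀ · pencil · P.map C` over `ℝ[X]` (proved). -/
theorem pencil_congr (d : Fin K → ℕ) (S : Fin K → Matrix (Fin 2) (Fin 2) ℝ) (P : Matrix (Fin 2) (Fin 2) ℝ) :
    pencil d (congr P S) = (P.map C)ᵀ * pencil d S * P.map C := by
  unfold pencil congr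
  rw [Finset.mul_sum, Finset.sum_mul]
  refine Finset.sum_congr rfl (fun l _ => ?_)
  rw [Matrix.mul_smul, Matrix.smul_mul, Matrix.map_mul, Matrix.map_mul, Matrix.transpose_map]

/-- (was STUB, now PROVED) congruence by an invertible constant matrix does not change the positive roots of the determinant
(`det (PᵀFP) = (det P)² · det F`). -/
theorem congr_posRoots (d : Fin K → ℕ) (S : Fin K → Matrix (Fin 2) (Fin 2) ℝ) (P : Matrix (Fin 2) (Fin 2) ℝ)
    (hP : P.det ≠ 0) : posRoots (pencil d (congr P S)).det = posRoots (pencil d S).det := by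
  unfold posRoots
  rw [pencil_congr, Matrix.det_mul, Matrix.det_mul, Matrix.det_transpose]
  have hdet : (P.map C).det = C P.det := by
    rw [show (P.map C) = (Polynomial.C : ℝ →+* ℝ[X]).mapMatrix P from rfl, ← RingHom.map_det]
  rw [hdet, mul_comm (C P.det) _, mul_assoc, ← C_mul, mul_comm, Polynomial.roots_C_mul _ (mul_ne_zero hP hP)]

/-- (was STUB, now PROVED) the compression of the congruent family along `eᵢ` is the compression of the original
family along the `i`-th column of `P`. -/
theorem comp_congr (d : Fin K → ℕ) (S : Fin K → Matrix (Fin 2) (Fin 2) ℝ) (P : Matrix (Fin 2) (Fin 2) ℝ)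
    (i : Fin 2) : comp d (congr P S) (Pi.single i 1) = comp d S (fun j => P j i) := by
  unfold comp congr
  refine Finset.sum_congr rfl (fun l _ => ?_)
  congr 2
  have : (Pi.single i (1:ℝ) : Fin 2 → ℝ) ⬝ᵥ (Pᵀ * S l * P).mulVec (Pi.single i 1)
      = (P.mulVec (Pi.single i 1)) ⬝ᵥ (S l).mulVec (P.mulVec (Pi.single i 1)) := by
    rw [← Matrix.mulVec_mulVec, ← Matrix.mulVec_mulVec, Matrix.dotProduct_mulVec, Matrix.vecMul_transpose]
  rw [this]
  congr 1 <;> [skip; congr 1] <;> (ext j; simp [Matrix.mulVec, dotProduct, Pi.single_apply])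

/-- evaluation of the compression: `f_w(t) = wᵀ F(t) w` (proved). -/
theorem comp_eval (d : Fin K → ℕ) (S : Fin K → Matrix (Fin 2) (Fin 2) ℝ) (w : Fin 2 → ℝ) (t : ℝ) :
    (comp d S w).eval t = w ⬝ᵥ (evalAt d S t).mulVec w := by
  unfold comp evalAt
  rw [Polynomial.eval_finsetSum, Matrix.sum_mulVec, dotProduct_sum]
  refine Finset.sum_congr rfl (fun l _ => ?_)
  rw [Polynomial.eval_mul, Polynomial.eval_C, Polynomial.eval_pow, Polynomial.eval_X, Matrix.smul_mulVec,
    dotProduct_smul, smul_eq_mul, mul_comm]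

/-- (was STUB, now PROVED) **a wrap costs a root of EVERY compression**: `F(x) ≻ 0`, `F(y) ≺ 0`, `x < y` ⇒ `f_w` has a root
in `(x,y)` for every `w ≠ 0` (IVT on `f_w(t) = wᵀF(t)w`).  Hence `w ≤ min_w Z₊(f_w) ≤ K − 1`. -/
theorem wrap_root (d : Fin K → ℕ) (S : Fin K → Matrix (Fin 2) (Fin 2) ℝ) (w : Fin 2 → ℝ) (hw : w ≠ 0)
    (x y : ℝ) (hx : 0 < x) (hxy : x < y) (hPx : (evalAt d S x).PosDef) (hNy : (-(evalAt d S y)).PosDef) :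
    ∃ r : ℝ, x < r ∧ r < y ∧ (comp d S w).IsRoot r := by
  have h1 : 0 < (comp d S w).eval x := by
    rw [comp_eval]; simpa using hPx.dotProduct_mulVec_pos hw
  have h2 : (comp d S w).eval y < 0 := by
    rw [comp_eval]
    have := hNy.dotProduct_mulVec_pos hw
    rw [Matrix.neg_mulVec, dotProduct_neg] at this
    simp only [star_trivial] at this
    linarith
  have hcont : ContinuousOn (fun t => (comp d S w).eval t) (Set.Icc x y) :=
    (Polynomial.continuous _).continuousOn
  have hivt := intermediate_value_Ioo' hxy.le hcont
  have h0 : (0:ℝ) ∈ Set.Ioo ((comp d S w).eval y) ((comp d S w).eval x) := ⟨h2, h1⟩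
  obtain ⟨r, ⟨hr1, hr2⟩, hr⟩ := hivt h0
  exact ⟨r, hr1, hr2, hr⟩

/-- (was STUB, now PROVED) **a lens costs two roots of every compression that sees it**: `F(x) ≻ 0`, `F(z) ≻ 0`,
`wᵀF(y)w < 0`, `x < y < z` ⇒ `f_w` has a root in `(x,y)` and one in `(y,z)`. -/
theorem lens_two_roots (d : Fin K → ℕ) (S : Fin K → Matrix (Fin 2) (Fin 2) ℝ) (w : Fin 2 → ℝ)
    (x y z : ℝ) (hx : 0 < x) (hxy : x < y) (hyz : y < z) (hPx : (evalAt d S x).PosDef) (hPz : (evalAt d S z).PosDef)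
    (hneg : w ⬝ᵥ (evalAt d S y).mulVec w < 0) :
    ∃ r₁ r₂ : ℝ, x < r₁ ∧ r₁ < y ∧ y < r₂ ∧ r₂ < z ∧ (comp d S w).IsRoot r₁ ∧ (comp d S w).IsRoot r₂ := by
  have hw : w ≠ 0 := by
    rintro rfl; simp at hneg
  have h1 : 0 < (comp d S w).eval x := by rw [comp_eval]; simpa using hPx.dotProduct_mulVec_pos hw
  have h2 : (comp d S w).eval y < 0 := by rw [comp_eval]; exact hneg
  have h3 : 0 < (comp d S w).eval z := by rw [comp_eval]; simpa using hPz.dotProduct_mulVec_pos hw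
  have hc1 : ContinuousOn (fun t => (comp d S w).eval t) (Set.Icc x y) := (Polynomial.continuous _).continuousOn
  have hc2 : ContinuousOn (fun t => (comp d S w).eval t) (Set.Icc y z) := (Polynomial.continuous _).continuousOn
  obtain ⟨r₁, ⟨h11, h12⟩, hr₁⟩ := intermediate_value_Ioo' hxy.le hc1 ⟨h2, h1⟩
  obtain ⟨r₂, ⟨h21, h22⟩, hr₂⟩ := intermediate_value_Ioo hyz.le hc2 ⟨h2, h3⟩
  exact ⟨r₁, r₂, h11, h12, h21, h22, hr₁, hr₂⟩

/-- the compression is a K-nomial (proved). -/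
theorem comp_support_card_le (d : Fin K → ℕ) (S : Fin K → Matrix (Fin 2) (Fin 2) ℝ) (w : Fin 2 → ℝ) :
    (comp d S w).support.card ≤ K := by
  classical
  unfold comp
  refine (Literature.Computability.AlgebraicComplexity.card_support_sum_le _ _).trans ?_
  calc ∑ l : Fin K, (C (w ⬝ᵥ (S l).mulVec w) * (X : ℝ[X]) ^ d l).support.card
      ≤ ∑ _l : Fin K, 1 := Finset.sum_le_sum (fun l _ => by
          rw [Polynomial.C_mul_X_pow_eq_monomial]
          exact (Finset.card_le_card (Polynomial.support_monomial_subset _ _)).trans (by simp))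
    _ = K := by simp

/-- (was STUB, now PROVED) **Descartes on a compression**: a nonzero K-nomial has at most `K − 1` positive roots
(`Literature…card_roots_toFinset_filter_pos_lt_card_support`). -/
theorem comp_descartes (d : Fin K → ℕ) (S : Fin K → Matrix (Fin 2) (Fin 2) ℝ) (w : Fin 2 → ℝ)
    (h : comp d S w ≠ 0) : posRoots (comp d S w) ≤ K - 1 := by
  classical
  have h1 := Literature.Computability.AlgebraicComplexity.card_roots_toFinset_filter_pos_lt_card_support h
  have h2 := comp_support_card_le d S w
  unfold posRoots
  have : (comp d S w).roots.toFinset.filter (fun x => 0 < x) = (comp d S w).roots.toFinset.filter (0 < ·) := rfl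
  omega

/-! ## 3. The two halves of the door (the load-bearing conjectural stubs) -/

/-- **(A) the door in the rootless frame** (located: 539 of the 540 record rows at `(2,6)`, all at 18). -/
def DoorRootlessFrame : Prop :=
  ∀ (d : Fin 6 → ℕ) (S : Fin 6 → Matrix (Fin 2) (Fin 2) ℝ), (∀ l, (S l).IsSymm) →
    HasRootlessFrame d S → posRoots (pencil d S).det ≤ 19

/-- **(A′) its diagonal normal form:** both diagonal entries without positive roots ⇒ ≤ 19. -/
def DoorDiagonalRootless : Prop :=
  ∀ (d : Fin 6 → ℕ) (S : Fin 6 → Matrix (Fin 2) (Fin 2) ℝ), (∀ l, (S l).IsSymm) →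
    (∀ i : Fin 2, ∀ x : ℝ, 0 < x → (comp d S (Pi.single i 1)).eval x ≠ 0) → posRoots (pencil d S).det ≤ 19

/-- **(B) the door without a rootless frame** (located: 1 of 540 record rows at `(2,6)`, at 18; 47 of 255 at `(2,4)`). -/
def DoorNoFrame : Prop :=
  ∀ (d : Fin 6 → ℕ) (S : Fin 6 → Matrix (Fin 2) (Fin 2) ℝ), (∀ l, (S l).IsSymm) →
    ¬ HasRootlessFrame d S → posRoots (pencil d S).det ≤ 19

/-- STUB (XL, half A). -/
theorem stub_door_rootlessFrame : DoorRootlessFrame := by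
  sorry

/-- STUB (XL, half B). -/
theorem stub_door_noFrame : DoorNoFrame := by
  sorry

/-! ## 4. Kernel compositions (no `sorry` below this line except through the named stubs) -/

/-- **WLOG DIAGONAL (proved, no hypotheses):** the diagonal normal form (A′) gives half (A) — congruence by the rootless
frame makes both diagonal entries rootless (`comp_congr`) and keeps the root count (`congr_posRoots`). -/
theorem doorRootlessFrame_of_diagonal (h : DoorDiagonalRootless) : DoorRootlessFrame := by
  intro d S hS hF
  obtain ⟨P, hP, hroot⟩ := hF
  have h1 := h d (congr P S) (congr_symm P S hS) (by
    intro i x hx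
    rw [comp_congr d S P i]
    exact hroot i x hx)
  rwa [congr_posRoots d S P hP] at h1

/-- equivalently: the two forms of half (A) are the same statement (the converse restricts to `P = 1`). -/
theorem doorRootlessFrame_iff_diagonal : DoorRootlessFrame ↔ DoorDiagonalRootless := by
  refine ⟨fun h d S hS hdiag => h d S hS ⟨1, by simp, ?_⟩, doorRootlessFrame_of_diagonal⟩
  intro i x hx
  have := hdiag i x hx
  convert this using 3
  ext j
  fin_cases i <;> fin_cases j <;> simp [Pi.single_apply]

/-- **THE DOOR FROM THE TWO HALVES** — `PosRootLawAt 2 6 19`. -/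
theorem posRootLawAt_two_six_of_halves (hA : DoorRootlessFrame) (hB : DoorNoFrame) : PosRootLawAt 2 6 19 := by
  intro d S hS
  by_cases hF : HasRootlessFrame d S
  · exact hA d S hS hF
  · exact hB d S hS hF

/-- the route item `DoorA26` (stmt-ValiantsHypothesis-19979) from the two halves, BY NAME. -/
theorem doorA26_of_halves (hA : DoorRootlessFrame) (hB : DoorNoFrame) :
    Summit.ValiantsHypothesis.ValiantsHypothesis.Theses.LacunarySymmetroid.DoorA26 :=
  posRootLawAt_two_six_of_halves hA hB

/-- zero-hypothesis composition through the stubs (the D-0145 `…_of` theorem). -/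
theorem doorA26_of_stubs : Summit.ValiantsHypothesis.ValiantsHypothesis.Theses.LacunarySymmetroid.DoorA26 :=
  doorA26_of_halves stub_door_rootlessFrame stub_door_noFrame

/-- and through the diagonal normal form. -/
theorem doorA26_of_diagonal_and_noFrame (h : DoorDiagonalRootless) (hB : DoorNoFrame) :
    Summit.ValiantsHypothesis.ValiantsHypothesis.Theses.LacunarySymmetroid.DoorA26 :=
  doorA26_of_halves (doorRootlessFrame_of_diagonal h) hB

/-! ## 5. Kill switch -/

/-- one symmetric `(2,6)` pencil with twenty positive roots kills both halves at once. -/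
theorem not_halves_of_twenty (d : Fin 6 → ℕ) (S : Fin 6 → Matrix (Fin 2) (Fin 2) ℝ) (hS : ∀ l, (S l).IsSymm)
    (h20 : 20 ≤ posRoots (pencil d S).det) : ¬ (DoorRootlessFrame ∧ DoorNoFrame) := by
  rintro ⟨hA, hB⟩
  have := posRootLawAt_two_six_of_halves hA hB d S hS
  unfold posRoots pencil at h20
  omega

end Summit.ValiantsHypothesis.ValiantsHypothesis.Cruxes.DoorA26.NappeWalk
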